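import Summits.KontsevichZagierPeriods.Zeta5Search.TwoTaleOmega.OmegaClosure
import Summits.KontsevichZagierPeriods.Zeta5Search.TwoTaleOmega.AefInstBlocks
import Summits.KontsevichZagierPeriods.Zeta5Search.Certificates.TwoTaleOmegaBaseEnum

/-!
# (bmiss)@Ω — direction `aef`, plug-in kit: from a certified aef rule step to the family data (cell `pub-zeta5`, cert-2 gen 5)

HONEST FRAMING: systematic search; recurrence certificates; no irrationality claim unless certified. Linear arithmetic and bookkeeping;
no named fact, no `sorry`.

A base point `p₀ ∈ StepBase (LegitSet CertU) dirAEF` of cert-2's Ω-induction (target `p₀ + 3δ` in the aef RULE domain, `a ≥ 17` there) has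
its four points in Ω, `a(p₀) ≥ 14`, and the shape inequalities of `TwoTaleOmegaRules.aef_shape` in base letters (`aef_stepBase_facts`); hence
`ofVec p₀` lies in the rule box `AefBox` (`aefBox_of_facts`).  Plus the dictionary `ofVec (q + k•dirAEF) = (ofVec q).addAEF k` and the reading of
the table coefficient `cAEFtab p₀ k` through the shape numerals (`cAEFtab_eq`).  The per-family plug lemmas are in `AefPlug*`.
-/

noncomputable section

open Finset
open Summit.KontsevichZagierPeriods.Zeta5Search.Certificates.TwoTaleTelescope

namespace Summit.KontsevichZagierPeriods.Zeta5Search.TwoTaleOmega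

/-- Moving along `dirAEF` is `addAEF`. -/
theorem ofVec_add_dirAEF (q : Certificates.TwoTaleTelescope.Pt) (k : ℤ) : ofVec (q + k • dirAEF) = (ofVec q).addAEF k := by
  simp [ofVec, Pt.addAEF, dirAEF]

/-- **Facts of a certified aef rule step** (base point `p₀`): the four points lie in Ω, `a(p₀) ≥ 14`, and the shape inequalities
`0 ≤ s, r`, `max(s,r)+1 ≤ b ≤ min(s,r)+3`, `min(s,r) ≤ 2`, `a+4 ≤ g ≤ a+6` (`s = a−e`, `r = a−f` in base letters). -/
theorem aef_stepBase_facts {p₀ : Certificates.TwoTaleTelescope.Pt}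
    (h : p₀ ∈ StepBase (fun δ p₀ => p₀ ∈ LegitSet CertU δ) dirAEF) :
    (∀ k : ℕ, k ≤ 3 → p₀ + (k : ℤ) • dirAEF ∈ Certificates.TwoTaleTelescope.Omega) ∧ 14 ≤ p₀ 0 ∧
    0 ≤ p₀ 0 - p₀ 2 ∧ 0 ≤ p₀ 0 - p₀ 3 ∧ p₀ 0 - p₀ 2 + 1 ≤ p₀ 1 ∧ p₀ 0 - p₀ 3 + 1 ≤ p₀ 1 ∧ p₀ 1 ≤ p₀ 0 - p₀ 2 + 3 ∧
      p₀ 1 ≤ p₀ 0 - p₀ 3 + 3 ∧ (p₀ 0 - p₀ 2 ≤ 2 ∨ p₀ 0 - p₀ 3 ≤ 2) ∧ p₀ 0 + 4 ≤ p₀ 4 ∧ p₀ 4 ≤ p₀ 0 + 6 := by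
  obtain ⟨-, hΩ, hleg⟩ := h
  obtain ⟨hr, -, h17⟩ := hleg
  have h17' := h17 (Or.inr rfl)
  rw [ruleDom_AEF] at hr
  obtain ⟨hApp, hg, hb, he, hf, hA⟩ := hr
  have hT : p₀ + (3 : ℤ) • dirAEF ∈ Certificates.TwoTaleTelescope.Omega := by simpa using hΩ 3 le_rfl
  have hs := aef_shape _ hT h17' hg hb he hf hA
  obtain ⟨e0, e1, e2, e3, e4⟩ := target_AEF p₀
  rw [e0, e1, e2, e3, e4] at hs
  rw [e0] at h17'
  refine ⟨hΩ, by omega, ?_⟩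
  omega

/-- The rule box of the base point from the step facts. -/
theorem aefBox_of_facts {p₀ : Certificates.TwoTaleTelescope.Pt}
    (h : p₀ ∈ StepBase (fun δ p₀ => p₀ ∈ LegitSet CertU δ) dirAEF) : (ofVec p₀).AefBox := by
  obtain ⟨hΩ, h14, hs⟩ := aef_stepBase_facts h
  have h0 : (ofVec p₀).Omega := by have := Omega_ofVec (hΩ 0 (by norm_num)); simpa using this
  obtain ⟨o1, o2, o3, o4, o5, o6, o7, o8, o9⟩ := h0
  simp only [ofVec_a, ofVec_b, ofVec_e, ofVec_f, ofVec_g] at o1 o2 o3 o4 o5 o6 o7 o8 o9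
  refine ⟨?_, ?_, ?_, ?_, ?_, ?_, ?_, ?_, ?_, ?_, ?_, ?_⟩ <;> simp only [ofVec_a, ofVec_b, ofVec_e, ofVec_f, ofVec_g] <;> omega

/-- The four points of the step in fam-tele's Ω, at `ofVec p₀` moved along `addAEF`. -/
theorem aef_omega_four {p₀ : Certificates.TwoTaleTelescope.Pt}
    (hΩ : ∀ k : ℕ, k ≤ 3 → p₀ + (k : ℤ) • dirAEF ∈ Certificates.TwoTaleTelescope.Omega) :
    (ofVec p₀).Omega ∧ ((ofVec p₀).addAEF 1).Omega ∧ ((ofVec p₀).addAEF 2).Omega ∧ ((ofVec p₀).addAEF 3).Omega := by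
  refine ⟨?_, ?_, ?_, ?_⟩
  · have := Omega_ofVec (hΩ 0 (by norm_num)); simpa using this
  · rw [← ofVec_add_dirAEF]; exact Omega_ofVec (by simpa using hΩ 1 (by norm_num))
  · rw [← ofVec_add_dirAEF]; exact Omega_ofVec (by simpa using hΩ 2 (by norm_num))
  · rw [← ofVec_add_dirAEF]; exact Omega_ofVec (by simpa using hΩ 3 (by norm_num))

/-- **Reading the table coefficient through the shape**: if the base point has shape numerals `(s, r, i, j)` then
`(cAEFtab p₀ k : ℚ) = upvalN (aefTab s r i j k) (a : ℚ)` with `a = p₀ 0 + 3` the target letter. -/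
theorem cAEFtab_eq {p₀ : Certificates.TwoTaleTelescope.Pt} {s r i j : ℕ} (hs : p₀ 0 - p₀ 2 = s) (hr : p₀ 0 - p₀ 3 = r)
    (hi : p₀ 1 - max (p₀ 0 - p₀ 2) (p₀ 0 - p₀ 3) - 1 = i) (hj : p₀ 4 - (p₀ 0 + 3) = j) (k : ℕ) :
    (cAEFtab p₀ k : ℚ) = upvalN (aefTab s r i j k) (((p₀ 0 + 3 : ℤ)) : ℚ) := by
  unfold cAEFtab
  obtain ⟨e0, e1, e2, e3, e4⟩ := target_AEF p₀
  rw [e0, e1, e2, e3, e4, upvalN_intCast]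
  have t1 : (p₀ 0 + 3 - (p₀ 2 + 3)).toNat = s := by omega
  have t2 : (p₀ 0 + 3 - (p₀ 3 + 3)).toNat = r := by omega
  have t3 : (p₀ 1 - max (p₀ 0 + 3 - (p₀ 2 + 3)) (p₀ 0 + 3 - (p₀ 3 + 3)) - 1).toNat = i := by
    rw [show p₀ 0 + 3 - (p₀ 2 + 3) = p₀ 0 - p₀ 2 by ring, show p₀ 0 + 3 - (p₀ 3 + 3) = p₀ 0 - p₀ 3 by ring]; omega
  have t4 : (p₀ 4 - (p₀ 0 + 3)).toNat = j := by omega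
  rw [t1, t2, t3, t4]

/-- The step relation in `Finset.sum` form from the four-term form (bookkeeping shared by all families). -/
theorem sum4_of_terms {c : ℕ → ℚ} {U : ℕ → ℚ} (h : c 0 * U 0 + c 1 * U 1 + c 2 * U 2 + c 3 * U 3 = 0) :
    ∑ k ∈ range 4, c k * U k = 0 := by
  rw [sum_range_succ, sum_range_succ, sum_range_succ, sum_range_one]; exact h

end Summit.KontsevichZagierPeriods.Zeta5Search.TwoTaleOmega

end
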